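import Literature.Combinatorics.SimpleGraph.LaplacianMaximumPrinciple
import Mathlib.GroupTheory.Perm.Cycle.Type
import HarnessLib

/-!
# Eulerian cuts and the parity of the number of spanning trees: `κ(G)` is even iff `G` has an
# Eulerian cut iff `Jac(G)` has an element of order two (Chen 1971; Baker–Norine 2009, §4.2
# Theorem 32 and Remark 33)

Source (held, read at the page; statements VERBATIM). M. Baker, S. Norine, *Harmonic morphisms
and hyperelliptic graphs*, Int. Math. Res. Not. IMRN 2009, no. 15, 2914–2955 [BakerNorine2009]
(held text `paper:arxiv-0707.1309`, chunks p0012–p0013). §4.2: «Let `κ_G = |Jac(G)|` denote the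
number of spanning trees in a graph `G`. […] Define an Eulerian cut in a graph `G` to be a non-empty
cut which is also an even subgraph of `G`; equivalently, an Eulerian cut is a partition of `V(G)`
into non-empty disjoint subsets `X` and `X′` in such a way that there are an even number of edges
connecting each vertex in `X` (resp. `X′`) to vertices in `X′` (resp. `X`). According to a theorem
of Chen [Chen] (see also [BiggsAPTG]), `G` has an Eulerian cut if and only if `κ_G` is even.»
**Theorem 32.** «Let `G` be a graph. Then the following are equivalent: (1) `G` has an Eulerian
cut. (2) There is a non-constant harmonic morphism from `G` to `B₂`. (3) `κ_G` is even.»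
Proof of (3) ⇒ (1) («borrowed from the unpublished manuscript [Eppstein]»): «Suppose that `κ_G`
is even. Then `Jac(G)` has an element of order 2 […] the set `S` of edges along which `ω` is
non-integral is non-empty. Since `δ(ω) = 0`, it follows that every vertex in `S` has even degree.
So it suffices to prove that `S` is a cut.» **Remark 33** ((1) ⇒ (3)): «Let `S` be an Eulerian
cut in `G` separating the subsets `X, Y ⊂ V(G)`. […] Define a divisor `D ∈ Div⁰(G)` by setting
`D(x) := ½ outdeg_X(x)` for `x ∈ X`, and `D(y) := −½ outdeg_Y(y)` for `y ∈ Y`. Then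
`2D = div(χ_X) ∼ 0`. However […] `D` itself is not equivalent to `0` […]. Thus `D` corresponds to
an element of order `2` in `Jac(G)`, and in particular `κ_G = |Jac(G)|` is even.»
W. K. Chen, *On vector spaces associated with a graph*, SIAM J. Appl. Math. 20 (1971) 526–529,
is the original source of (1) ⇔ (3) (cited through [BakerNorine2009]).

## What is formalised (simple connected graphs; the lineage vocabulary `laplacianLattice G` =
## `Prin(G)`, `criticalGroup G` = `Jac(G)`, `charFun X` = `χ_X`, `Δ(f) = G.lapMatrix ℤ *ᵥ f`)

* `IsEulerianCut G X`: `X` and `Xᶜ` non-empty, and every vertex has an even number of neighbours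
  on the other side (the printed «equivalently» form);
* **(1) ⇒ (3)** through Remark 33's divisor: `2D = Δ(χ_X)` with `D(x) = ½ outdeg_X(x)` on `X`,
  `−½ outdeg_{Xᶜ}` off `X` (`two_mul_halfCutDivisor`), and `D ∉ Prin(G)`
  (`halfCutDivisor_notMem_laplacianLattice`; here by parity: `D = Δ(g)` would make `χ_X − 2g`
  harmonic, hence constant, hence `χ_X` constant — the source instead bounds `D ≤ ν` by Theorem 5);
* **(3) ⇒ (1)** ([Eppstein]'s argument read on potentials): if `D ∉ Prin(G)` but `2D = Δ(f)`,
  the vertices where `f` is even form an Eulerian cut (`isEulerianCut_of_two_mul_eq`);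
* the equivalences **Theorem 32 (1) ⇔ (3)**: `∃` Eulerian cut `⇔ ∃ D ∈ Div(G)`, `D ∉ Prin(G)`,
  `2D ∈ Prin(G)` `⇔ Jac(G)` has an element of order `2` `⇔ |Jac(G)|` even `⇔ κ(G)` even
  (`exists_isEulerianCut_iff_even_card_spanningTrees`, Chen's theorem).
Statement (2) concerns the multigraph `B₂` (two vertices, two parallel edges) and is outside the
simple-graph setting of `HarmonicMorphisms`; it is not typed here.

One definition with body and theorems; no `sorry`; no named facts.
-/

open Finset SimpleGraph Matrix
open Literature.Combinatorics.SimpleGraph.ChipFiring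

namespace Literature.Combinatorics.SimpleGraph.BakerNorine

variable {V : Type*} [Fintype V] [DecidableEq V] (G : SimpleGraph V) [DecidableRel G.Adj]

/-! ### §1 Eulerian cuts and Remark 33's half-cut divisor -/

/-- An **Eulerian cut** (the side `X`): «a partition of `V(G)` into non-empty disjoint subsets
`X` and `X′` in such a way that there are an even number of edges connecting each vertex in `X`
(resp. `X′`) to vertices in `X′` (resp. `X`)». [cite: BakerNorine2009, §4.2] -/
def IsEulerianCut (X : Finset V) : Prop :=
  X.Nonempty ∧ Xᶜ.Nonempty ∧ (∀ v ∈ X, Even #(G.neighborFinset v \ X)) ∧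
    ∀ v ∉ X, Even #(G.neighborFinset v ∩ X)

/-- Unfolding `IsEulerianCut`. [cite: BakerNorine2009, §4.2] -/
theorem isEulerianCut_iff (X : Finset V) :
    IsEulerianCut G X ↔ X.Nonempty ∧ Xᶜ.Nonempty ∧ (∀ v ∈ X, Even #(G.neighborFinset v \ X)) ∧
      ∀ v ∉ X, Even #(G.neighborFinset v ∩ X) := Iff.rfl

/-- Remark 33's divisor: «`D(x) := ½ outdeg_X(x)` for `x ∈ X`, and `D(y) := −½ outdeg_Y(y)` for
`y ∈ Y`» (`Y = Xᶜ`; integer division, exact for an Eulerian cut). [cite: BakerNorine2009, Remark 33] -/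
def halfCutDivisor (X : Finset V) : V → ℤ := fun v =>
  if v ∈ X then (#(G.neighborFinset v \ X) : ℤ) / 2 else -((#(G.neighborFinset v ∩ X) : ℤ) / 2)

/-- Unfolding `halfCutDivisor`. [cite: BakerNorine2009, Remark 33] -/
theorem halfCutDivisor_apply (X : Finset V) (v : V) :
    halfCutDivisor G X v = if v ∈ X then (#(G.neighborFinset v \ X) : ℤ) / 2
      else -((#(G.neighborFinset v ∩ X) : ℤ) / 2) := rfl

/-- `Δ(χ_X)(v) = outdeg_X(v)` on `X` and `−|N(v) ∩ X|` off `X`.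
[cite: BakerNorine2009, Remark 33 («`2D = div(χ_X)`»)] -/
theorem lapMatrix_mulVec_charFun_eq (X : Finset V) (v : V) :
    (G.lapMatrix ℤ *ᵥ charFun X) v =
      if v ∈ X then (#(G.neighborFinset v \ X) : ℤ) else -(#(G.neighborFinset v ∩ X) : ℤ) := by
  split_ifs with hv
  · have h := sub_mulVec_charFun_apply_of_mem G 0 hv
    rw [Pi.sub_apply, Pi.zero_apply, zero_sub] at h
    linarith
  · have h := sub_mulVec_charFun_apply_of_not_mem G 0 hv
    rw [Pi.sub_apply, Pi.zero_apply, zero_sub] at h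
    linarith

variable {G}

/-- **Remark 33**: for an Eulerian cut, `2D = div(χ_X)`. [cite: BakerNorine2009, Remark 33] -/
theorem IsEulerianCut.two_mul_halfCutDivisor {X : Finset V} (hX : IsEulerianCut G X) :
    2 * halfCutDivisor G X = G.lapMatrix ℤ *ᵥ charFun X := by
  funext v
  rw [Pi.mul_apply, Pi.ofNat_apply, halfCutDivisor_apply, lapMatrix_mulVec_charFun_eq]
  split_ifs with hv
  · obtain ⟨k, hk⟩ := hX.2.2.1 v hv
    rw [hk]
    omega
  · obtain ⟨k, hk⟩ := hX.2.2.2 v hv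
    rw [hk]
    omega

/-- **Remark 33**: `D ∈ Div⁰(G)` («Define a divisor `D ∈ Div⁰(G)`»).
[cite: BakerNorine2009, Remark 33] -/
theorem IsEulerianCut.sum_halfCutDivisor {X : Finset V} (hX : IsEulerianCut G X) :
    ∑ v, halfCutDivisor G X v = 0 := by
  have h := congrArg (fun D : V → ℤ => ∑ v, D v) hX.two_mul_halfCutDivisor
  simp only [Pi.mul_apply, Pi.ofNat_apply, ← Finset.mul_sum, sum_lapMatrix_mulVec] at h
  omega

/-- If `Δ(χ_X) = 2Δ(g)` on a connected graph then `χ_X` is constant, i.e. `X = ∅` or `X = V`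
(`χ_X − 2g` is harmonic, hence constant, and `χ_X ∈ {0, 1}`).
[cite: BakerNorine2009, Remark 33 («`D` itself is not equivalent to `0`»)] -/
theorem charFun_const_of_lapMatrix_mulVec_eq (hG : G.Connected) {X : Finset V} {g : V → ℤ}
    (h : G.lapMatrix ℤ *ᵥ charFun X = 2 * (G.lapMatrix ℤ *ᵥ g)) (v w : V) :
    (v ∈ X ↔ w ∈ X) := by
  have hharm : G.lapMatrix ℤ *ᵥ (charFun X - 2 * g) = 0 := by
    rw [Matrix.mulVec_sub, h]
    have : G.lapMatrix ℤ *ᵥ (2 * g) = 2 * (G.lapMatrix ℤ *ᵥ g) := by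
      funext u
      simp only [Matrix.mulVec, dotProduct, Pi.mul_apply, Pi.ofNat_apply, Finset.mul_sum]
      exact Finset.sum_congr rfl fun x _ => by ring
    rw [this, sub_self]
  have hc := (lapMatrix_mulVec_eq_zero_iff_forall_eq hG _).1 hharm v w
  simp only [Pi.sub_apply, Pi.mul_apply, Pi.ofNat_apply, charFun_apply] at hc
  by_cases hv : v ∈ X <;> by_cases hw : w ∈ X <;> simp only [hv, hw, if_true, if_false] at hc ⊢
    <;> omega

/-- **Remark 33**: `D` is not principal («using Theorem 5, we see that `D` itself is not
equivalent to `0`»; here: `D = Δ(g)` would force `χ_X` constant, but `X, Xᶜ ≠ ∅`).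
[cite: BakerNorine2009, Remark 33] -/
theorem IsEulerianCut.halfCutDivisor_notMem_laplacianLattice (hG : G.Connected) {X : Finset V}
    (hX : IsEulerianCut G X) : halfCutDivisor G X ∉ laplacianLattice G := by
  intro hmem
  obtain ⟨g, hg⟩ := (mem_laplacianLattice_iff G _).1 hmem
  obtain ⟨v, hv⟩ := hX.1
  obtain ⟨w, hw⟩ := hX.2.1
  rw [Finset.mem_compl] at hw
  have h := hX.two_mul_halfCutDivisor
  rw [← hg] at h
  exact hw ((charFun_const_of_lapMatrix_mulVec_eq hG h.symm v w).1 hv)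

/-- **(1) ⇒ (3), divisor form**: an Eulerian cut yields a degree-`0` divisor `D ∉ Prin(G)` with
`2D ∈ Prin(G)` («`D` corresponds to an element of order `2` in `Jac(G)`»).
[cite: BakerNorine2009, Remark 33] -/
theorem IsEulerianCut.exists_two_torsion (hG : G.Connected) {X : Finset V}
    (hX : IsEulerianCut G X) :
    ∃ D : V → ℤ, ∑ v, D v = 0 ∧ D ∉ laplacianLattice G ∧ 2 * D ∈ laplacianLattice G :=
  ⟨halfCutDivisor G X, hX.sum_halfCutDivisor, hX.halfCutDivisor_notMem_laplacianLattice hG,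
    (mem_laplacianLattice_iff G _).2 ⟨charFun X, hX.two_mul_halfCutDivisor.symm⟩⟩

/-! ### §2 (3) ⇒ (1): the parity cut of a half-principal divisor -/

/-- `Δ(f)(v) ≡ |{u ∼ v : f(u) ≢ f(v) (mod 2)}| (mod 2)`: if `Δ(f) = 2D`, every vertex has an even
number of neighbours of the opposite `f`-parity («Since `δ(ω) = 0`, it follows that every vertex
in `S` has even degree»). [cite: BakerNorine2009, Theorem 32 (proof of (3) ⇒ (1))] -/
theorem even_card_filter_of_lapMatrix_mulVec_eq {f D : V → ℤ}
    (h : G.lapMatrix ℤ *ᵥ f = 2 * D) (v : V) :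
    Even #{u ∈ G.neighborFinset v | ¬ (Even (f u) ↔ Even (f v))} := by
  -- `Σ_{u ∼ v} (f v − f u) = 2 D(v)`; reduce modulo 2
  have hv : ∑ u ∈ G.neighborFinset v, (f v - f u) = 2 * D v := by
    have := congrFun h v
    rw [lapMatrix_mulVec_apply, Pi.mul_apply, Pi.ofNat_apply] at this
    rw [Finset.sum_sub_distrib, Finset.sum_const, card_neighborFinset_eq_degree, nsmul_eq_mul]
    exact this
  have hcast : ((∑ u ∈ G.neighborFinset v, (f v - f u) : ℤ) : ZMod 2) =
      (#{u ∈ G.neighborFinset v | ¬ (Even (f u) ↔ Even (f v))} : ZMod 2) := by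
    rw [Int.cast_sum, Finset.natCast_card_filter]
    refine Finset.sum_congr rfl fun u _ => ?_
    by_cases hp : (Even (f u) ↔ Even (f v))
    · rw [if_neg (not_not.2 hp), (ZMod.intCast_eq_zero_iff_even).2]
      rw [Int.even_sub]
      exact hp.symm
    · rw [if_pos hp]
      have hodd : Odd (f v - f u) := by
        rw [Int.odd_sub, ← Int.not_even_iff_odd]
        tauto
      obtain ⟨k, hk⟩ := hodd
      rw [hk]
      push_cast
      rw [(by decide : (2 : ZMod 2) = 0), zero_mul, zero_add]
  rw [hv] at hcast
  push_cast at hcast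
  rw [(by decide : (2 : ZMod 2) = 0), zero_mul] at hcast
  exact (ZMod.natCast_eq_zero_iff_even).1 hcast.symm

/-- **(3) ⇒ (1)**: if `D ∉ Prin(G)` but `2D = Δ(f)`, then the vertices of even `f`-value form an
Eulerian cut ([Eppstein]'s half-integral flow, read on the potential `f/2`; the cut is non-trivial
because a constant parity would make `D = Δ((f − c)/2)` principal).
[cite: BakerNorine2009, Theorem 32 (proof of (3) ⇒ (1))] -/
theorem isEulerianCut_of_two_mul_eq {f D : V → ℤ} (h : G.lapMatrix ℤ *ᵥ f = 2 * D)
    (hD : D ∉ laplacianLattice G) : IsEulerianCut G (univ.filter fun v => Even (f v)) := by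
  -- if all `f v` had the parity of `f v₀`, `D = Δ((f − f v₀ % 2)/2)` would be principal
  have hmixed : ∀ v₀ : V, ∃ w, ¬ (Even (f w) ↔ Even (f v₀)) := by
    intro v₀
    by_contra hall
    push Not at hall
    apply hD
    rw [mem_laplacianLattice_iff]
    refine ⟨fun v => (f v - f v₀ % 2) / 2, ?_⟩
    have hdiv : ∀ v, 2 ∣ f v - f v₀ % 2 := fun v => by
      have h1 : Even (f v) ↔ Even (f v₀) := hall v
      rcases Int.emod_two_eq_zero_or_one (f v₀) with h0 | h0 <;> rw [h0]
      · rw [sub_zero, ← even_iff_two_dvd, h1, Int.even_iff]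
        exact h0
      · rw [← even_iff_two_dvd, Int.even_sub_one, h1, Int.even_iff]
        omega
    have h2 : (2 : V → ℤ) * (fun v => (f v - f v₀ % 2) / 2) = f - fun _ => f v₀ % 2 := by
      funext v
      simp only [Pi.mul_apply, Pi.ofNat_apply, Pi.sub_apply]
      exact Int.mul_ediv_cancel' (hdiv v)
    have h3 : G.lapMatrix ℤ *ᵥ ((2 : V → ℤ) * fun v => (f v - f v₀ % 2) / 2) = 2 * D := by
      rw [h2, Matrix.mulVec_sub, h]
      have : G.lapMatrix ℤ *ᵥ (fun _ : V => f v₀ % 2) = 0 := by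
        have := SimpleGraph.lapMatrix_mulVec_const_eq_zero G (R := ℤ)
        have hc : (fun _ : V => f v₀ % 2) = (f v₀ % 2) • fun _ : V => (1 : ℤ) := by
          funext v; simp
        rw [hc, Matrix.mulVec_smul, this, smul_zero]
      rw [this, sub_zero]
    have h4 : G.lapMatrix ℤ *ᵥ ((2 : V → ℤ) * fun v => (f v - f v₀ % 2) / 2) =
        2 * (G.lapMatrix ℤ *ᵥ fun v => (f v - f v₀ % 2) / 2) := by
      funext u
      simp only [Matrix.mulVec, dotProduct, Pi.mul_apply, Pi.ofNat_apply, Finset.mul_sum]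
      exact Finset.sum_congr rfl fun x _ => by ring
    rw [h4] at h3
    funext v
    have := congrFun h3 v
    simp only [Pi.mul_apply, Pi.ofNat_apply] at this
    omega
  refine ⟨?_, ?_, ?_, ?_⟩
  · -- the even side is non-empty: otherwise everything is odd, contradicting `hmixed`
    by_contra hne
    rw [Finset.not_nonempty_iff_eq_empty, Finset.filter_eq_empty_iff] at hne
    obtain ⟨v₀⟩ : Nonempty V := by
      by_contra hV
      rw [not_nonempty_iff] at hV
      apply hD
      rw [mem_laplacianLattice_iff]
      exact ⟨0, funext fun v => (IsEmpty.false v).elim⟩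
    obtain ⟨w, hw⟩ := hmixed v₀
    exact hw ⟨fun h => absurd h (hne (mem_univ w)), fun h => absurd h (hne (mem_univ v₀))⟩
  · by_contra hne
    rw [Finset.not_nonempty_iff_eq_empty, Finset.compl_eq_empty_iff, Finset.filter_eq_self] at hne
    obtain ⟨v₀⟩ : Nonempty V := by
      by_contra hV
      rw [not_nonempty_iff] at hV
      apply hD
      rw [mem_laplacianLattice_iff]
      exact ⟨0, funext fun v => (IsEmpty.false v).elim⟩
    obtain ⟨w, hw⟩ := hmixed v₀
    exact hw ⟨fun _ => hne v₀ (mem_univ v₀), fun _ => hne w (mem_univ w)⟩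
  · intro v hv
    have hv' : Even (f v) := (mem_filter.1 hv).2
    have := even_card_filter_of_lapMatrix_mulVec_eq h v
    convert this using 2
    ext u
    simp only [mem_sdiff, mem_filter, mem_univ, true_and, mem_neighborFinset]
    exact and_congr_right fun _ => by tauto
  · intro v hv
    have hv' : ¬ Even (f v) := fun he => hv (mem_filter.2 ⟨mem_univ _, he⟩)
    have := even_card_filter_of_lapMatrix_mulVec_eq h v
    convert this using 2
    ext u
    simp only [mem_inter, mem_filter, mem_univ, true_and, mem_neighborFinset]
    exact and_congr_right fun _ => by tauto

/-- **Theorem 32, divisor form**: `G` (connected) has an Eulerian cut iff some divisor `D` has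
`D ∉ Prin(G)` and `2D ∈ Prin(G)`. [cite: BakerNorine2009, Theorem 32 and Remark 33] -/
theorem exists_isEulerianCut_iff_exists_two_torsion (hG : G.Connected) :
    (∃ X, IsEulerianCut G X) ↔
      ∃ D : V → ℤ, D ∉ laplacianLattice G ∧ 2 * D ∈ laplacianLattice G := by
  constructor
  · rintro ⟨X, hX⟩
    obtain ⟨D, -, h1, h2⟩ := hX.exists_two_torsion hG
    exact ⟨D, h1, h2⟩
  · rintro ⟨D, hD, h2D⟩
    obtain ⟨f, hf⟩ := (mem_laplacianLattice_iff G _).1 h2D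
    exact ⟨_, isEulerianCut_of_two_mul_eq hf hD⟩

/-! ### §3 Theorem 32 (1) ⇔ (3): Eulerian cuts, `Jac(G)[2]`, and the parity of `κ(G)` -/

/-- A divisor `D ∉ Prin(G)` with `2D ∈ Prin(G)` (necessarily of degree `0`) is exactly an element
of order `2` of `Jac(G)`. [cite: BakerNorine2009, Theorem 32 (proof: «`Jac(G)` has an element of
order 2») and Remark 33] -/
theorem exists_two_torsion_iff_exists_addOrderOf_eq_two :
    (∃ D : V → ℤ, D ∉ laplacianLattice G ∧ 2 * D ∈ laplacianLattice G) ↔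
      ∃ c : criticalGroup G, addOrderOf c = 2 := by
  haveI : Fact (Nat.Prime 2) := ⟨Nat.prime_two⟩
  constructor
  · rintro ⟨D, hD, h2D⟩
    -- `deg D = 0` since `2 deg D = deg(2D) = 0`
    have hD0 : D ∈ zeroSumLattice V := by
      rw [mem_zeroSumLattice_iff]
      have h := (mem_zeroSumLattice_iff _).1 (laplacianLattice_le_zeroSumLattice G h2D)
      simp only [Pi.mul_apply, Pi.ofNat_apply, ← Finset.mul_sum] at h
      omega
    refine ⟨QuotientAddGroup.mk ⟨D, hD0⟩, ?_⟩
    rw [addOrderOf_eq_prime_iff]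
    constructor
    · rw [← QuotientAddGroup.mk_nsmul, QuotientAddGroup.eq_zero_iff, AddSubgroup.mem_addSubgroupOf]
      convert h2D using 1
      funext v
      simp [two_mul, two_nsmul]
    · rw [Ne, QuotientAddGroup.eq_zero_iff, AddSubgroup.mem_addSubgroupOf]
      exact hD
  · rintro ⟨c, hc⟩
    obtain ⟨D, rfl⟩ := QuotientAddGroup.mk_surjective c
    rw [addOrderOf_eq_prime_iff] at hc
    refine ⟨(D : V → ℤ), ?_, ?_⟩
    · intro hD
      exact hc.2 ((QuotientAddGroup.eq_zero_iff _).2 (AddSubgroup.mem_addSubgroupOf.2 hD))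
    · have h := hc.1
      rw [← QuotientAddGroup.mk_nsmul, QuotientAddGroup.eq_zero_iff,
        AddSubgroup.mem_addSubgroupOf] at h
      convert h using 1
      funext v
      simp [two_mul, two_nsmul]

/-- `Jac(G)` has an element of order `2` iff `|Jac(G)|` is even (`G` connected, so `Jac(G)` is
finite; Lagrange and Cauchy). [cite: BakerNorine2009, Theorem 32 (proof of (2) ⇒ (3) and
(3) ⇒ (1))] -/
theorem exists_addOrderOf_eq_two_iff_even_card_criticalGroup (hG : G.Connected) :
    (∃ c : criticalGroup G, addOrderOf c = 2) ↔ Even (Nat.card (criticalGroup G)) := by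
  haveI : Fact (Nat.Prime 2) := ⟨Nat.prime_two⟩
  haveI : Finite (criticalGroup G) :=
    Nat.finite_of_card_ne_zero (card_criticalGroup_pos G hG).ne'
  constructor
  · rintro ⟨c, hc⟩
    rw [even_iff_two_dvd, ← hc]
    exact addOrderOf_dvd_natCard c
  · intro h
    exact exists_prime_addOrderOf_dvd_card' 2 (even_iff_two_dvd.1 h)

/-- **Theorem 32 (1) ⇔ (3) on `Jac`**: `G` has an Eulerian cut iff `|Jac(G)|` is even.
[cite: BakerNorine2009, Theorem 32] -/
theorem exists_isEulerianCut_iff_even_card_criticalGroup (hG : G.Connected) :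
    (∃ X, IsEulerianCut G X) ↔ Even (Nat.card (criticalGroup G)) := by
  rw [exists_isEulerianCut_iff_exists_two_torsion hG,
    exists_two_torsion_iff_exists_addOrderOf_eq_two,
    exists_addOrderOf_eq_two_iff_even_card_criticalGroup hG]

/-- **Theorem 32 (1) ⇔ (3) (Chen's theorem)**: «`G` has an Eulerian cut if and only if `κ_G` is
even», `κ_G` the number of spanning trees (`G` connected). [cite: BakerNorine2009, Theorem 32] -/
theorem exists_isEulerianCut_iff_even_card_spanningTrees (hG : G.Connected) :
    (∃ X, IsEulerianCut G X) ↔ Even (Nat.card {T : SimpleGraph V // T ≤ G ∧ T.IsTree}) := by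
  rw [exists_isEulerianCut_iff_even_card_criticalGroup hG, card_criticalGroup G hG]

end Literature.Combinatorics.SimpleGraph.BakerNorine
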